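import Literature.NumberTheory.GaloisCohomology.Howard2004.Thm161PrintIntendedOfEngineBricks
import Summits.BirchSwinnertonDyer.BirchSwinnertonDyer.Theorems.PoitouTateSelmerStructureDualityConjHolds
import HarnessLib

set_option linter.dupNamespace false -- `…BirchSwinnertonDyer.BirchSwinnertonDyer…` is the cell's nested layout (D-0017)
set_option autoImplicit false

/-!
# G87 (Howard 2004, Thm. 1.6.1 as intended by its printed proof, F-161′) from the ONE print leaf C45.1′ —
# Poitou–Tate duality discharged by the tree (helper for `stub_h161` of stmt-BirchSwinnertonDyer-22642)

`--supports` stmt-BirchSwinnertonDyer-22642 (`MuInequalityCoherentPair`; print leaf G87 = `thm161_dvrKolyvaginBound`,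
by-name target F-161′ = `thm161_dvrKolyvaginBound_printIntended`, cell `pub/bsd-print-x9`).  THEOREMS ONLY (no definition,
no named fact, no `sorry`).

The Literature closing term `DVRSetting.thm161_printIntended_of_prop141` (x10b-p1-w2 g17, «Thm161OfEngineBricks») proves
F-161′ from the cite-only print fact C45.1′ `prop141_casselsTate_skewPairing_atLevel` (Howard Prop. 1.4.1 / Thm. 1.4.2 as
applied) and a binder `∀ K, poitouTate_selmerStructure_duality_conj K`.  The latter is a THEOREM of the tree at every number
field: `InputsPoitouTateSelmer.poitouTate_selmerStructure_duality_conj_holds K` (route-free module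
`Theorems.PoitouTateSelmerStructureDualityConjHolds`).  This file discharges it, leaving F-161′ conditional on C45.1′ ALONE.

Honest framing: CONDITIONAL on the cite-only print fact C45.1′; the verbatim-as-worded F-161 (no guards) is not proved;
no crux and no summit statement is proved; the Birch–Swinnerton-Dyer conjecture is NOT proved by any of this.
References: [Howard2004HeegnerKolyvagin] Thm. 1.6.1, Prop. 1.4.1, Thm. 1.4.2; [MilneADT2006] Ch. I, Thm. 4.10 (b).
-/

namespace Summit.BirchSwinnertonDyer.BirchSwinnertonDyer.Theorems.HowardThm161PrintIntended

open Literature.NumberTheory.GaloisCohomology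
open Literature.NumberTheory.GaloisCohomology.Howard2004

/-- **Howard 2004, Thm. 1.6.1 as intended by its printed proof (F-161′) from the print leaf C45.1′ alone**:
`prop141_casselsTate_skewPairing_atLevel → thm161_dvrKolyvaginBound_printIntended`, Poitou–Tate duality for Selmer
structures being supplied by the tree (`poitouTate_selmerStructure_duality_conj_holds`).  Conditional on C45.1′; the
as-worded F-161 is not proved; BSD is not proved by this.
[cite: Howard2004HeegnerKolyvagin, Thm. 1.6.1 (arXiv:1202.6340 Thm. 2.6.1, p. 11 L17–32), Prop. 1.4.1, Thm. 1.4.2]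
[cite: MilneADT2006, Ch. I, Thm. 4.10 (b)] -/
theorem thm161_printIntended_of_prop141 (h141 : prop141_casselsTate_skewPairing_atLevel) :
    thm161_dvrKolyvaginBound_printIntended :=
  DVRSetting.thm161_printIntended_of_prop141 h141 fun K _ _ =>
    InputsPoitouTateSelmer.poitouTate_selmerStructure_duality_conj_holds K

end Summit.BirchSwinnertonDyer.BirchSwinnertonDyer.Theorems.HowardThm161PrintIntended
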